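import Summits.ValiantsHypothesis.ValiantsHypothesis.Theorems.LiftNullstellensatzLiftWidthPerFourCaseAZero
import Summits.ValiantsHypothesis.ValiantsHypothesis.Theorems.LiftNullstellensatzLiftWidthPerFourReduction

/-!
# Route LiftNullstellensatz — `LiftWidthPerFour` (stmt-ValiantsHypothesis-5922):
`per_4` has no homogeneous ABP of format `(≤4, ≤5, ≤4)`

Consequence of the first rung of CASE A (`caseA_zero`, `…CaseAZero`) and of the outer-layer
analysis (Claim F `linearSpace_perm4_row_or_col`, R2 `perPoly_not_mem_rowIdeal_mul_rowIdeal`,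
R3 `perPoly_not_mem_rowIdeal_mul_colIdeal`): when an outer layer has only `≤ 4` forms, Claim F
makes its span EXACTLY a row or column space (no extra form `ℓ`), so the four-shape dispatch of
the `outer_layers` line closes with `ℓ = ℓ' = 0`:

* `layer_row_or_col_of_le_four` — the `ℓ`-free outer normal form for `a ≤ 4`;
* `perPoly_ne_abp_le_four` — `per_4 ≠ L₁ L₂ L₃ L₄` for linear matrices of format `(a,b,c)`,
  `a ≤ 4`, `b ≤ 5`, `c ≤ 4` (dispatch adapted from `liftWidthPerFour_of_caseA`, p573778);
* `six_le_rank_middle_of_outer_le_four` — for every word-lift `Ψ` of `per_4` whose `(1,3)` and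
  `(3,1)` flattenings have rank `≤ 4`, the middle `(2,2)` flattening has rank `≥ 6` (Nisan normal
  form `exists_abp_of_rank_le`).  Grenet's `(4,6,4)` is thus optimal among programs of outer width
  `4`; the crux `LiftWidthPerFour` itself (outer width `5`) stays open.

No new definitions.  VP ≠ VNP is not moved by this item.
-/

noncomputable section

open MvPolynomial

namespace Summit.ValiantsHypothesis.LiftNullstellensatz

open Literature.Computability.AlgebraicComplexity

/-- The `ℓ`-free outer normal form: if a layer of a homogeneous ABP for `per_4` has `a ≤ 4` forms,
they all lie in `span(x_{i,·})` for one row `i` or in `span(x_{·,j})` for one column `j`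
(Claim F on the common kernel, of dimension `≥ 12`, then a dimension count). [folklore] -/
theorem layer_row_or_col_of_le_four {a : ℕ} (ha : a ≤ 4) (L₁ : Fin 4 × Fin 4 → Fin a → ℂ)
    (hvan : ∀ A : Matrix (Fin 4) (Fin 4) ℂ, (∀ k, ∑ x, L₁ x k * A x.1 x.2 = 0) → A.permanent = 0) :
    (∃ i : Fin 4, ∀ k, (∑ x, L₁ x k • (X x : MvPolynomial (Fin 4 × Fin 4) ℂ)) ∈ Submodule.span ℂ
        (Set.range fun j : Fin 4 => (X (i, j) : MvPolynomial (Fin 4 × Fin 4) ℂ))) ∨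
    (∃ j : Fin 4, ∀ k, (∑ x, L₁ x k • (X x : MvPolynomial (Fin 4 × Fin 4) ℂ)) ∈ Submodule.span ℂ
        (Set.range fun i : Fin 4 => (X (i, j) : MvPolynomial (Fin 4 × Fin 4) ℂ))) := by
  classical
  obtain ⟨ℓ, -, h⟩ := layer_normal_form (ha.trans (by norm_num)) L₁ hvan
  -- the span `T` of the layer forms has dimension ≤ a ≤ 4
  set T : Submodule ℂ (MvPolynomial (Fin 4 × Fin 4) ℂ) :=
    Submodule.span ℂ (Set.range fun k => ∑ x, L₁ x k • (X x : MvPolynomial (Fin 4 × Fin 4) ℂ)) with hT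
  haveI : FiniteDimensional ℂ T := FiniteDimensional.span_of_finite ℂ (Set.finite_range _)
  have hTdim : Module.finrank ℂ T ≤ 4 := by
    have := finrank_range_le_card (R := ℂ) fun k => ∑ x, L₁ x k • (X x : MvPolynomial (Fin 4 × Fin 4) ℂ)
    rw [Fintype.card_fin] at this
    exact this.trans ha
  -- a 4-dimensional coordinate space inside `T` is all of `T`
  have key : ∀ v : Fin 4 → Fin 4 × Fin 4, Function.Injective v →
      (∀ j, (X (v j) : MvPolynomial (Fin 4 × Fin 4) ℂ) ∈ T) →
      ∀ k, (∑ x, L₁ x k • (X x : MvPolynomial (Fin 4 × Fin 4) ℂ)) ∈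
        Submodule.span ℂ (Set.range fun j => (X (v j) : MvPolynomial (Fin 4 × Fin 4) ℂ)) := by
    intro v hv hX k
    set S : Submodule ℂ (MvPolynomial (Fin 4 × Fin 4) ℂ) :=
      Submodule.span ℂ (Set.range fun j => (X (v j) : MvPolynomial (Fin 4 × Fin 4) ℂ)) with hS
    have hli : LinearIndependent ℂ fun j => (X (v j) : MvPolynomial (Fin 4 × Fin 4) ℂ) :=
      (linearIndependent_X (Fin 4 × Fin 4) ℂ).comp v hv
    have hSdim : Module.finrank ℂ S = 4 := by
      rw [hS, finrank_span_eq_card hli, Fintype.card_fin]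
    have hST : S ≤ T := by
      rw [hS, Submodule.span_le]; rintro _ ⟨j, rfl⟩; exact hX j
    have hEq : S = T := Submodule.eq_of_le_of_finrank_le hST (by omega)
    have : (∑ x, L₁ x k • (X x : MvPolynomial (Fin 4 × Fin 4) ℂ)) ∈ T := Submodule.subset_span ⟨k, rfl⟩
    rwa [← hEq] at this
  -- Claim F on the common kernel, as in `layer_normal_form`
  let Φ : Matrix (Fin 4) (Fin 4) ℂ →ₗ[ℂ] (Fin a → ℂ) :=
    LinearMap.pi fun k => ∑ x : Fin 4 × Fin 4, L₁ x k • Matrix.entryLinearMap ℂ ℂ x.1 x.2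
  have hΦ : ∀ A k, Φ A k = ∑ x, L₁ x k * A x.1 x.2 := by
    intro A k
    simp only [Φ, LinearMap.pi_apply, LinearMap.coe_sum, Finset.sum_apply, LinearMap.smul_apply,
      Matrix.entryLinearMap_apply, smul_eq_mul]
  set W : Submodule ℂ (Matrix (Fin 4) (Fin 4) ℂ) := LinearMap.ker Φ with hW
  have hWmem : ∀ A, A ∈ W ↔ ∀ k, ∑ x, L₁ x k * A x.1 x.2 = 0 := by
    intro A
    rw [hW, LinearMap.mem_ker]
    constructor
    · intro h' k; rw [← hΦ, h']; rfl
    · intro h'; funext k; rw [hΦ]; exact h' k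
  have hdim : 11 ≤ Module.finrank ℂ W := by
    have h1 := LinearMap.finrank_range_add_finrank_ker Φ
    have h2 : Module.finrank ℂ (Matrix (Fin 4) (Fin 4) ℂ) = 16 := by
      rw [Module.finrank_matrix]; simp
    have h3 : Module.finrank ℂ (LinearMap.range Φ) ≤ a := by
      calc Module.finrank ℂ (LinearMap.range Φ) ≤ Module.finrank ℂ (Fin a → ℂ) :=
            Submodule.finrank_le _
        _ = a := by simp
    rw [hW]; omega
  have hper : ∀ A ∈ W, A.permanent = 0 := fun A hA => hvan A ((hWmem A).1 hA)
  rcases linearSpace_perm4_row_or_col (K := ℂ) two_ne_zero W hdim hper with ⟨i, hi⟩ | ⟨j, hj⟩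
  · refine Or.inl ⟨i, key (fun j => (i, j)) (fun j j' e => (Prod.mk.inj e).2) fun j => ?_⟩
    refine X_mem_span_of_forall_kernel L₁ (i, j) fun v hv => ?_
    exact hi (Matrix.of fun p q => v (p, q)) ((hWmem _).2 (by simpa using hv)) j
  · refine Or.inr ⟨j, key (fun i => (i, j)) (fun i i' e => (Prod.mk.inj e).1) fun i => ?_⟩
    refine X_mem_span_of_forall_kernel L₁ (i, j) fun v hv => ?_
    exact hj (Matrix.of fun p q => v (p, q)) ((hWmem _).2 (by simpa using hv)) i

/-- The row/row dispatch at `ℓ = ℓ' = 0`: an ABP of format `(a, b ≤ 5, c)` for `per_4` whose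
first-layer forms lie in `span(x_{i,·})` and last-layer forms in `span(x_{i',·})` is impossible
(`i = i'`: R2; `i ≠ i'`: `caseA_zero` on the middle cut). [folklore] -/
theorem false_of_abp_rows {a b c : ℕ} (hb : b ≤ 5)
    (L₁ : Fin 4 × Fin 4 → Fin a → ℂ) (L₂ : Fin 4 × Fin 4 → Fin a → Fin b → ℂ)
    (L₃ : Fin 4 × Fin 4 → Fin b → Fin c → ℂ) (L₄ : Fin 4 × Fin 4 → Fin c → ℂ)
    (hEq : perPoly (Fin 4) ℂ = ∑ k, ∑ s, ∑ t,
      (∑ x, L₁ x k • (X x : MvPolynomial (Fin 4 × Fin 4) ℂ)) * (∑ x, L₂ x k s • X x) *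
      (∑ x, L₃ x s t • X x) * (∑ x, L₄ x t • X x))
    (i i' : Fin 4)
    (hi : ∀ k, (∑ x, L₁ x k • (X x : MvPolynomial (Fin 4 × Fin 4) ℂ)) ∈ Submodule.span ℂ
      (Set.range fun j : Fin 4 => (X (i, j) : MvPolynomial (Fin 4 × Fin 4) ℂ)))
    (hi' : ∀ t, (∑ x, L₄ x t • (X x : MvPolynomial (Fin 4 × Fin 4) ℂ)) ∈ Submodule.span ℂ
      (Set.range fun j : Fin 4 => (X (i', j) : MvPolynomial (Fin 4 × Fin 4) ℂ))) : False := by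
  classical
  by_cases hii : i = i'
  · subst hii
    have h0 : (0 : MvPolynomial (Fin 4 × Fin 4) ℂ).IsHomogeneous 1 := isHomogeneous_zero _ _ _
    refine perPoly_not_mem_rowIdeal_mul_rowIdeal (K := ℂ) two_ne_zero i 0 0 h0 h0 ?_
    simp only [Ideal.span_insert_zero]
    rw [hEq]
    refine Ideal.sum_mem _ fun k _ => Ideal.sum_mem _ fun s _ => Ideal.sum_mem _ fun t _ => ?_
    have e : ∀ (A B C D : MvPolynomial (Fin 4 × Fin 4) ℂ), A * B * C * D = (A * (B * C)) * D :=
      fun A B C D => by ring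
    rw [e]
    exact Ideal.mul_mem_mul (Ideal.mul_mem_right _ _ (mem_idealSpan_of_mem_span (hi k)))
      (mem_idealSpan_of_mem_span (hi' t))
  · refine caseA_zero (K := ℂ) two_ne_zero b hb i i' hii
      (fun s => ∑ k, (∑ x, L₁ x k • (X x : MvPolynomial (Fin 4 × Fin 4) ℂ)) * (∑ x, L₂ x k s • X x))
      (fun s => ∑ t, (∑ x, L₃ x s t • (X x : MvPolynomial (Fin 4 × Fin 4) ℂ)) * (∑ x, L₄ x t • X x))
      (fun s => Ideal.sum_mem _ fun k _ =>
        Ideal.mul_mem_right _ _ (mem_idealSpan_of_mem_span (hi k)))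
      (fun s => IsHomogeneous.sum _ _ _ fun k _ =>
        (Literature.RingTheory.MvPolynomial.isHomogeneous_one_sum_smul_X _).mul
          (Literature.RingTheory.MvPolynomial.isHomogeneous_one_sum_smul_X _))
      (fun s => Ideal.sum_mem _ fun t _ =>
        Ideal.mul_mem_left _ _ (mem_idealSpan_of_mem_span (hi' t)))
      (fun s => IsHomogeneous.sum _ _ _ fun t _ =>
        (Literature.RingTheory.MvPolynomial.isHomogeneous_one_sum_smul_X _).mul
          (Literature.RingTheory.MvPolynomial.isHomogeneous_one_sum_smul_X _)) ?_
    rw [hEq, Finset.sum_comm]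
    refine Finset.sum_congr rfl fun s _ => ?_
    rw [Finset.sum_mul_sum]
    refine Finset.sum_congr rfl fun k _ => Finset.sum_congr rfl fun t _ => ?_
    ring

/-- **No homogeneous ABP of format `(≤4, ≤5, ≤4)` for `per_4`**: `per_4 ≠ L₁ L₂ L₃ L₄` for
matrices of linear forms of sizes `1×a, a×b, b×c, c×1` with `a ≤ 4`, `b ≤ 5`, `c ≤ 4`.
Dispatch over the four outer shapes with `ℓ = ℓ' = 0`: same row (R2), row/column (R3),
column/column (transpose to row/row), two different rows (`caseA_zero`). [folklore] -/
theorem perPoly_ne_abp_le_four (a b c : ℕ) (ha : a ≤ 4) (hb : b ≤ 5) (hc : c ≤ 4)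
    (L₁ : Fin 4 × Fin 4 → Fin a → ℂ) (L₂ : Fin 4 × Fin 4 → Fin a → Fin b → ℂ)
    (L₃ : Fin 4 × Fin 4 → Fin b → Fin c → ℂ) (L₄ : Fin 4 × Fin 4 → Fin c → ℂ) :
    perPoly (Fin 4) ℂ ≠ ∑ k, ∑ s, ∑ t,
      (∑ x, L₁ x k • (X x : MvPolynomial (Fin 4 × Fin 4) ℂ)) * (∑ x, L₂ x k s • X x) *
      (∑ x, L₃ x s t • X x) * (∑ x, L₄ x t • X x) := by
  classical
  intro hEq
  have hvan1 : ∀ A : Matrix (Fin 4) (Fin 4) ℂ, (∀ k, ∑ x, L₁ x k * A x.1 x.2 = 0) →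
      A.permanent = 0 := by
    intro A hA
    have := congrArg (eval fun x : Fin 4 × Fin 4 => A x.1 x.2) hEq
    rw [eval_perPoly_eq_permanent] at this
    rw [this]
    simp only [map_sum, map_mul, smul_eval, eval_X, hA, zero_mul, Finset.sum_const_zero]
  have hvan4 : ∀ A : Matrix (Fin 4) (Fin 4) ℂ, (∀ t, ∑ x, L₄ x t * A x.1 x.2 = 0) →
      A.permanent = 0 := by
    intro A hA
    have := congrArg (eval fun x : Fin 4 × Fin 4 => A x.1 x.2) hEq
    rw [eval_perPoly_eq_permanent] at this
    rw [this]
    simp only [map_sum, map_mul, smul_eval, eval_X, hA, mul_zero, Finset.sum_const_zero]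
  -- the product-ideal membership used by R3
  have hmemII : ∀ (s₁ s₄ : Set (MvPolynomial (Fin 4 × Fin 4) ℂ)),
      (∀ k, (∑ x, L₁ x k • (X x : MvPolynomial (Fin 4 × Fin 4) ℂ)) ∈ Submodule.span ℂ s₁) →
      (∀ t, (∑ x, L₄ x t • (X x : MvPolynomial (Fin 4 × Fin 4) ℂ)) ∈ Submodule.span ℂ s₄) →
      perPoly (Fin 4) ℂ ∈ Ideal.span s₁ * Ideal.span s₄ := by
    intro s₁ s₄ h1 h4
    rw [hEq]
    refine Ideal.sum_mem _ fun k _ => Ideal.sum_mem _ fun s _ => Ideal.sum_mem _ fun t _ => ?_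
    have e : (∑ x, L₁ x k • (X x : MvPolynomial (Fin 4 × Fin 4) ℂ)) * (∑ x, L₂ x k s • X x) *
        (∑ x, L₃ x s t • X x) * (∑ x, L₄ x t • X x) =
        ((∑ x, L₁ x k • (X x : MvPolynomial (Fin 4 × Fin 4) ℂ)) * ((∑ x, L₂ x k s • X x) *
        (∑ x, L₃ x s t • X x))) * (∑ x, L₄ x t • X x) := by ring
    rw [e]
    exact Ideal.mul_mem_mul (Ideal.mul_mem_right _ _ (mem_idealSpan_of_mem_span (h1 k)))
      (mem_idealSpan_of_mem_span (h4 t))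
  have h0 : (0 : MvPolynomial (Fin 4 × Fin 4) ℂ).IsHomogeneous 1 := isHomogeneous_zero _ _ _
  rcases layer_row_or_col_of_le_four ha L₁ hvan1 with ⟨i, hi⟩ | ⟨j, hj⟩
  · rcases layer_row_or_col_of_le_four hc L₄ hvan4 with ⟨i', hi'⟩ | ⟨j', hj'⟩
    · exact false_of_abp_rows hb L₁ L₂ L₃ L₄ hEq i i' hi hi'
    · refine perPoly_not_mem_rowIdeal_mul_colIdeal (K := ℂ) two_ne_zero i j' 0 0 h0 h0 ?_
      simp only [Ideal.span_insert_zero]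
      exact hmemII _ _ hi hj'
  · rcases layer_row_or_col_of_le_four hc L₄ hvan4 with ⟨i', hi'⟩ | ⟨j', hj'⟩
    · refine perPoly_not_mem_rowIdeal_mul_colIdeal (K := ℂ) two_ne_zero i' j 0 0 h0 h0 ?_
      simp only [Ideal.span_insert_zero]
      rw [mul_comm]
      exact hmemII _ _ hj hi'
    · -- column/column: transpose the whole ABP (as in `liftWidthPerFour_of_caseA`)
      let τ : MvPolynomial (Fin 4 × Fin 4) ℂ →ₐ[ℂ] MvPolynomial (Fin 4 × Fin 4) ℂ := rename Prod.swap
      have hτlin : ∀ (L : Fin 4 × Fin 4 → ℂ), τ (∑ x, L x • (X x : MvPolynomial (Fin 4 × Fin 4) ℂ)) =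
          ∑ x, L x.swap • (X x : MvPolynomial (Fin 4 × Fin 4) ℂ) := by
        intro L
        simp only [τ, map_sum, map_smul, rename_X]
        exact Fintype.sum_equiv (Equiv.prodComm (Fin 4) (Fin 4)) _ _ fun x => by simp
      set M₁ : Fin 4 × Fin 4 → Fin a → ℂ := fun x k => L₁ x.swap k with hM₁
      set M₂ : Fin 4 × Fin 4 → Fin a → Fin b → ℂ := fun x k s => L₂ x.swap k s with hM₂
      set M₃ : Fin 4 × Fin 4 → Fin b → Fin c → ℂ := fun x s t => L₃ x.swap s t with hM₃
      set M₄ : Fin 4 × Fin 4 → Fin c → ℂ := fun x t => L₄ x.swap t with hM₄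
      have hEq' : perPoly (Fin 4) ℂ = ∑ k, ∑ s, ∑ t,
          (∑ x, M₁ x k • (X x : MvPolynomial (Fin 4 × Fin 4) ℂ)) * (∑ x, M₂ x k s • X x) *
          (∑ x, M₃ x s t • X x) * (∑ x, M₄ x t • X x) := by
        have := congrArg τ hEq
        rw [show τ (perPoly (Fin 4) ℂ) = perPoly (Fin 4) ℂ from rename_swap_perPoly 4] at this
        rw [this]
        simp only [map_sum, map_mul, hτlin, hM₁, hM₂, hM₃, hM₄]
      have hτmem : ∀ (L : Fin 4 × Fin 4 → ℂ) (j₀ : Fin 4),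
          (∑ x, L x • (X x : MvPolynomial (Fin 4 × Fin 4) ℂ)) ∈ Submodule.span ℂ
            (Set.range fun i : Fin 4 => (X (i, j₀) : MvPolynomial (Fin 4 × Fin 4) ℂ)) →
          (∑ x, L x.swap • (X x : MvPolynomial (Fin 4 × Fin 4) ℂ)) ∈ Submodule.span ℂ
            (Set.range fun i : Fin 4 => (X (j₀, i) : MvPolynomial (Fin 4 × Fin 4) ℂ)) := by
        intro L j₀ hm
        rw [← hτlin]
        have := Submodule.mem_map_of_mem (f := τ.toLinearMap) hm
        rw [Submodule.map_span] at this
        refine Submodule.span_mono ?_ this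
        rintro _ ⟨y, ⟨i, rfl⟩, rfl⟩
        exact ⟨i, by simp [τ]⟩
      exact false_of_abp_rows hb M₁ M₂ M₃ M₄ hEq' j j'
        (fun k => hτmem (fun x => L₁ x k) j (hj k)) (fun t => hτmem (fun x => L₄ x t) j' (hj' t))

/-- **The `(4,·,4)` width profile needs middle width `≥ 6`.**  For every word-lift `Ψ` of `per_4`
whose `(1,3)`- and `(3,1)`-flattenings have rank `≤ 4`, the middle `(2,2)`-flattening has rank
`≥ 6` (Nisan normal form `exists_abp_of_rank_le` + `perPoly_ne_abp_le_four`).  In particular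
Grenet's program of format `(4,6,4)` is optimal among programs of outer width `4`. [folklore] -/
theorem six_le_rank_middle_of_outer_le_four (Ψ : (Fin 4 → Fin 4 × Fin 4) → ℂ)
    (hΨ : (∑ w : Fin 4 → Fin 4 × Fin 4, Ψ w • ∏ t, (X (w t) : MvPolynomial (Fin 4 × Fin 4) ℂ)) =
      perPoly (Fin 4) ℂ)
    (h₁₃ : 1 + 3 = 4) (h₂₂ : 2 + 2 = 4) (h₃₁ : 3 + 1 = 4)
    (hr₁ : (Matrix.of fun (u : Fin 1 → Fin 4 × Fin 4) (v : Fin 3 → Fin 4 × Fin 4) =>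
      Ψ (fun t => Fin.append u v (Fin.cast h₁₃.symm t))).rank ≤ 4)
    (hr₃ : (Matrix.of fun (u : Fin 3 → Fin 4 × Fin 4) (v : Fin 1 → Fin 4 × Fin 4) =>
      Ψ (fun t => Fin.append u v (Fin.cast h₃₁.symm t))).rank ≤ 4) :
    6 ≤ (Matrix.of fun (u : Fin 2 → Fin 4 × Fin 4) (v : Fin 2 → Fin 4 × Fin 4) =>
      Ψ (fun t => Fin.append u v (Fin.cast h₂₂.symm t))).rank := by
  by_contra hlt
  push Not at hlt
  obtain ⟨a, b, c, ha, hb, hc, L₁, L₂, L₃, L₄, hL⟩ :=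
    exists_abp_of_rank_le Ψ h₁₃ h₂₂ h₃₁ hr₁ (Nat.lt_succ_iff.mp hlt) hr₃
  have h := sum_word_eq_abp Ψ L₁ L₂ L₃ L₄ hL
  rw [hΨ] at h
  exact perPoly_ne_abp_le_four a b c ha hb hc L₁ L₂ L₃ L₄ h

end Summit.ValiantsHypothesis.LiftNullstellensatz

end
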